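import Literature.RepresentationTheory.CompactGroups.TranslationFinite
import HarnessLib

/-!
# The augmentation ideal of the representative functions and point derivations

Continuation of `TranslationFinite`: for a topological group `G` let `R = translationFinite G`
be the algebra of translation-finite (representative) real functions and
`K = augIdeal G = {a ∈ R | a(1) = 0}` its augmentation ideal. From the finite expansion
`a(xz) = Σ a(x yᵢ) wᵢ(z)` one gets, for `a ∈ K`, the **Hopf-algebraic identity**
`a(xz) - a(x) - a(z) = Σ αᵢ(x) βᵢ(z)` with `αᵢ, βᵢ ∈ K` (`exists_expansion_aug`), and, putting
`z = x⁻¹`, `a + ǎ = -Σ αᵢ β̌ᵢ ∈ K·K` where `ǔ(x) = u(x⁻¹)` (`exists_self_add_invTrans`): inversion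
acts as `-1` on `K/K²` (the differential of `g ↦ g⁻¹` at `1` is `-id`). Consequences:

* a linear functional on `C(G, ℝ)` which on `R` is inversion-symmetric, kills `K·K` and `1`,
  vanishes on `R` (`eq_zero_of_symm_of_mul_aug`): this is how a *symmetric* Gaussian generating
  functional is determined by its quadratic form on `K/K²`, and how two such functionals with
  proportional forms are compared;
* **point derivations** at `1` (`IsPointDerivation δ`: `δ(uv) = u(1) δ(v) + v(1) δ(u)` on `R`)
  kill `1` and `K·K` and are inversion-antisymmetric, `δ(ǔ) = -δ(u)`
  (`IsPointDerivation.apply_invTrans`).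

These are the algebraic inputs for the generating functional of a heat kernel and for the
Lie-free structure theory (one-parameter subgroups from point derivations) used in
`Literature.MathematicalPhysics.QuantumLattice.isGroupHeatKernel_unique_up_to_scale`.
Source: G. Hochschild, *The Structure of Lie Groups* (1965), Ch. II §§1–3 (representative
functions, proper automorphisms and differentials); T. Bröcker, T. tom Dieck (1985), III §1.
No named facts.
-/

noncomputable section

namespace Literature.RepresentationTheory.CompactGroups

/-! ### Evaluation at the identity and the augmentation ideal -/

section EvalOne

variable (G : Type*) [TopologicalSpace G] [One G]

/-- Evaluation at `1 ∈ G` as a linear functional on `C(G, ℝ)` (the counit of the Hopf algebra of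
representative functions). [folklore] -/
def evalOne : C(G, ℝ) →ₗ[ℝ] ℝ where
  toFun u := u 1
  map_add' _ _ := rfl
  map_smul' _ _ := rfl

/-- Unfolding `evalOne`. [folklore] -/
@[simp] theorem evalOne_apply (u : C(G, ℝ)) : evalOne G u = u 1 := rfl

end EvalOne

variable {G : Type*} [TopologicalSpace G] [Group G] [IsTopologicalGroup G]

variable (G) in
/-- The **augmentation ideal** `K = {a ∈ R | a(1) = 0}` of the algebra `R = translationFinite G`
of representative functions (Hochschild 1965, II §3). [folklore] -/
def augIdeal : Submodule ℝ C(G, ℝ) :=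
  Subalgebra.toSubmodule (translationFinite G) ⊓ LinearMap.ker (evalOne G)

/-- Membership in the augmentation ideal. [folklore] -/
theorem mem_augIdeal_iff {a : C(G, ℝ)} : a ∈ augIdeal G ↔ a ∈ translationFinite G ∧ a 1 = 0 :=
  Iff.rfl

/-- Elements of `K` vanish at `1`. [folklore] -/
theorem apply_one_of_mem_augIdeal {a : C(G, ℝ)} (ha : a ∈ augIdeal G) : a 1 = 0 := ha.2

/-- `u - u(1) ∈ K` for `u ∈ R`. [folklore] -/
theorem sub_const_mem_augIdeal {u : C(G, ℝ)} (hu : u ∈ translationFinite G) :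
    u - algebraMap ℝ C(G, ℝ) (u 1) ∈ augIdeal G :=
  ⟨(translationFinite G).sub_mem hu ((translationFinite G).algebraMap_mem _), by simp⟩

/-- `K` is an ideal of `R`: `a u ∈ K` for `a ∈ K`, `u ∈ R`. [folklore] -/
theorem mul_mem_augIdeal {a u : C(G, ℝ)} (ha : a ∈ augIdeal G) (hu : u ∈ translationFinite G) :
    a * u ∈ augIdeal G :=
  ⟨(translationFinite G).mul_mem ha.1 hu, by
    change a 1 * u 1 = 0
    rw [apply_one_of_mem_augIdeal ha, zero_mul]⟩

/-- `K` is stable under inversion `ǎ(x) = a(x⁻¹)`. [folklore] -/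
theorem invTrans_mem_augIdeal {a : C(G, ℝ)} (ha : a ∈ augIdeal G) : invTrans a ∈ augIdeal G :=
  ⟨invTrans_mem_translationFinite ha.1, by
    change a 1⁻¹ = 0
    rw [inv_one, apply_one_of_mem_augIdeal ha]⟩

/-- `K` is stable under conjugation `a ↦ a(g · g⁻¹)`. [folklore] -/
theorem conj_mem_augIdeal {a : C(G, ℝ)} (ha : a ∈ augIdeal G) (g : G) :
    lTrans g (rTrans g⁻¹ a) ∈ augIdeal G :=
  ⟨lTrans_mem_translationFinite (rTrans_mem_translationFinite ha.1 _) _, by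
    change a (g * 1 * g⁻¹) = 0
    rw [mul_one, mul_inv_cancel, apply_one_of_mem_augIdeal ha]⟩

/-! ### The Hopf identity `a(xz) - a(x) - a(z) ∈ K ⊗ K` and `a + ǎ ∈ K·K` -/

/-- For `a ∈ K` there are finitely many `αᵢ, βᵢ ∈ K` with `a(xz) - a(x) - a(z) = Σᵢ αᵢ(x) βᵢ(z)`
for all `x, z` (from the finite expansion `a(xz) = Σ a(x yᵢ) wᵢ(z)`: take
`αᵢ = a(· yᵢ) - a(yᵢ)`, `βᵢ = wᵢ - wᵢ(1)` and use `a(1) = 0`). In Hopf-algebra terms,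
`Δa - a ⊗ 1 - 1 ⊗ a ∈ K ⊗ K`. [folklore] -/
theorem exists_expansion_aug {a : C(G, ℝ)} (ha : a ∈ augIdeal G) :
    ∃ (s : Finset G) (α β : G → C(G, ℝ)), (∀ y, α y ∈ augIdeal G) ∧ (∀ y, β y ∈ augIdeal G) ∧
      ∀ x z, a (x * z) - a x - a z = ∑ y ∈ s, α y x * β y z := by
  obtain ⟨s, w, hw, hexp⟩ := IsTranslationFinite.exists_expansion ha.1
  refine ⟨s, fun y => rTrans y a - algebraMap ℝ C(G, ℝ) (a y),
    fun y => w y - algebraMap ℝ C(G, ℝ) (w y 1), fun y => ?_, fun y => ?_, fun x z => ?_⟩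
  · have := sub_const_mem_augIdeal (rTrans_mem_translationFinite ha.1 y)
    simpa using this
  · exact sub_const_mem_augIdeal (biSpan_le_translationFinite ha.1 (hw y))
  · have h1 := hexp x z
    have hx := hexp x 1
    have hz := hexp 1 z
    have h11 := hexp 1 1
    simp only [mul_one, one_mul] at hx hz h11
    -- `Σ (a(x y) - a(y)) (w(z) - w(1)) = Σ a(xy)w(z) - Σ a(xy) w(1) - Σ a(y) w(z) + Σ a(y) w(1)`
    have : ∑ y ∈ s, (rTrans y a - algebraMap ℝ C(G, ℝ) (a y)) x *
        (w y - algebraMap ℝ C(G, ℝ) (w y 1)) z =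
        ∑ y ∈ s, a (x * y) * w y z - ∑ y ∈ s, a (x * y) * w y 1 - ∑ y ∈ s, a y * w y z +
          ∑ y ∈ s, a y * w y 1 := by
      simp only [ContinuousMap.sub_apply, rTrans_apply, Algebra.algebraMap_eq_smul_one,
        ContinuousMap.smul_apply, ContinuousMap.one_apply, smul_eq_mul, mul_one,
        ← Finset.sum_sub_distrib, ← Finset.sum_add_distrib]
      refine Finset.sum_congr rfl fun y _ => ?_
      ring
    rw [this, ← h1, ← hx, ← hz, ← h11, apply_one_of_mem_augIdeal ha]
    ring

/-- **Inversion acts as `-1` modulo `K·K`**: for `a ∈ K` there are `αᵢ, γᵢ ∈ K` with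
`a + ǎ = -Σ αᵢ γᵢ` (put `z = x⁻¹` in `exists_expansion_aug`; `γᵢ = β̌ᵢ`). [folklore] -/
theorem exists_self_add_invTrans {a : C(G, ℝ)} (ha : a ∈ augIdeal G) :
    ∃ (s : Finset G) (α γ : G → C(G, ℝ)), (∀ y, α y ∈ augIdeal G) ∧ (∀ y, γ y ∈ augIdeal G) ∧
      a + invTrans a = -∑ y ∈ s, α y * γ y := by
  obtain ⟨s, α, β, hα, hβ, h⟩ := exists_expansion_aug ha
  refine ⟨s, α, fun y => invTrans (β y), hα, fun y => invTrans_mem_augIdeal (hβ y), ?_⟩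
  ext x
  have := h x x⁻¹
  rw [mul_inv_cancel, apply_one_of_mem_augIdeal ha] at this
  simp only [ContinuousMap.add_apply, invTrans_apply, ContinuousMap.neg_apply,
    ContinuousMap.coe_sum, Finset.sum_apply, ContinuousMap.mul_apply]
  linarith

/-- A linear functional on `C(G, ℝ)` which, on the representative functions, is symmetric under
inversion and kills `1` and all products `a b` with `a, b ∈ K`, vanishes on all of `R`
(write `u = u(1) + a`, `2 φ(a) = φ(a + ǎ) = -Σ φ(αᵢ γᵢ) = 0`). [folklore] -/
theorem eq_zero_of_symm_of_mul_aug (φ : C(G, ℝ) →ₗ[ℝ] ℝ)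
    (hS : ∀ u ∈ translationFinite G, φ (invTrans u) = φ u)
    (hK : ∀ a ∈ augIdeal G, ∀ b ∈ augIdeal G, φ (a * b) = 0) (h1 : φ 1 = 0) :
    ∀ u ∈ translationFinite G, φ u = 0 := by
  have haug : ∀ a ∈ augIdeal G, φ a = 0 := by
    intro a ha
    obtain ⟨s, α, γ, hα, hγ, h⟩ := exists_self_add_invTrans ha
    have h2 : φ (a + invTrans a) = 0 := by
      rw [h, map_neg, map_sum, neg_eq_zero]
      exact Finset.sum_eq_zero fun y _ => hK _ (hα y) _ (hγ y)
    rw [map_add, hS a ha.1] at h2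
    linarith
  intro u hu
  have hsplit : u = (u - algebraMap ℝ C(G, ℝ) (u 1)) + (u 1) • (1 : C(G, ℝ)) := by
    rw [Algebra.algebraMap_eq_smul_one]; abel
  rw [hsplit, map_add, map_smul, haug _ (sub_const_mem_augIdeal hu), h1, smul_zero, add_zero]

/-! ### Point derivations at the identity -/

/-- `δ` is a **point derivation at `1`** of the algebra of representative functions:
`δ(uv) = u(1) δ(v) + v(1) δ(u)` for `u, v ∈ R` (a tangent vector at the identity in the sense of
the Hopf algebra `R`; Hochschild 1965, II §3). Only the values of `δ` on `R` matter. [folklore] -/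
def IsPointDerivation (δ : C(G, ℝ) →ₗ[ℝ] ℝ) : Prop :=
  ∀ u ∈ translationFinite G, ∀ v ∈ translationFinite G, δ (u * v) = u 1 * δ v + v 1 * δ u

namespace IsPointDerivation

variable {δ : C(G, ℝ) →ₗ[ℝ] ℝ}

/-- A point derivation kills constants: `δ 1 = 0`. [folklore] -/
theorem apply_one (hδ : IsPointDerivation δ) : δ 1 = 0 := by
  have := hδ 1 (translationFinite G).one_mem 1 (translationFinite G).one_mem
  simp only [mul_one, ContinuousMap.one_apply, one_mul] at this
  linarith

/-- A point derivation kills `K·K`. [folklore] -/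
theorem apply_mul_aug (hδ : IsPointDerivation δ) {a b : C(G, ℝ)} (ha : a ∈ augIdeal G)
    (hb : b ∈ augIdeal G) : δ (a * b) = 0 := by
  rw [hδ a ha.1 b hb.1, apply_one_of_mem_augIdeal ha, apply_one_of_mem_augIdeal hb]; ring

/-- **Point derivations are odd under inversion**: `δ(ǔ) = -δ(u)` for `u ∈ R` (apply
`eq_zero_of_symm_of_mul_aug` to `φ = δ + δ ∘ inv`). [folklore] -/
theorem apply_invTrans (hδ : IsPointDerivation δ) {u : C(G, ℝ)} (hu : u ∈ translationFinite G) :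
    δ (invTrans u) = -δ u := by
  let φ : C(G, ℝ) →ₗ[ℝ] ℝ := δ + δ.comp (invTrans (G := G)).toLinearMap
  have hφ : ∀ v, φ v = δ v + δ (invTrans v) := fun v => rfl
  have hS : ∀ v ∈ translationFinite G, φ (invTrans v) = φ v := fun v _ => by
    rw [hφ, hφ, invTrans_invTrans, add_comm]
  have hK : ∀ a ∈ augIdeal G, ∀ b ∈ augIdeal G, φ (a * b) = 0 := fun a ha b hb => by
    rw [hφ, hδ.apply_mul_aug ha hb, map_mul,
      hδ.apply_mul_aug (invTrans_mem_augIdeal ha) (invTrans_mem_augIdeal hb), add_zero]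
  have h1 : φ 1 = 0 := by
    rw [hφ, map_one (invTrans (G := G)), hδ.apply_one, add_zero]
  have := eq_zero_of_symm_of_mul_aug φ hS hK h1 u hu
  rw [hφ] at this
  linarith

/-- `δ(a) = δ(u)` for `a = u - u(1)`. [folklore] -/
theorem apply_sub_const (hδ : IsPointDerivation δ) (u : C(G, ℝ)) :
    δ (u - algebraMap ℝ C(G, ℝ) (u 1)) = δ u := by
  rw [map_sub, Algebra.algebraMap_eq_smul_one, map_smul, hδ.apply_one, smul_zero, sub_zero]

end IsPointDerivation

end Literature.RepresentationTheory.CompactGroups
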